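import Mathlib
import Summits.MatrixMultiplication.MatrixMultiplication.Theses.LevelGradedCohnUmans
import Summits.MatrixMultiplication.MatrixMultiplication.Theorems.SnLevelDesigns.Negative.DeadCorners
import Summits.MatrixMultiplication.MatrixMultiplication.Theorems.SnLevelDesigns.Negative.DimensionWalls
import Summits.MatrixMultiplication.MatrixMultiplication.Theorems.LevelGradedCohnUmansSnLevelDesignsStubFixedSetToken
import Summits.MatrixMultiplication.MatrixMultiplication.Theorems.LevelGradedCohnUmansSnLevelDesignsStubDimensionDecay

/-!
# Line `fixed-set-certificates` — skeleton for crux `SnLevelDesigns` (stmt-MatrixMultiplication-7613)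

Route `LevelGradedCohnUmans`, crux `SnLevelDesigns` (rank 4):
`∀ ε > 0 ∃ n k X Y Z ⊆ 𝔖ₙ`, `k`-token separated, with `∑_{μ₁ ≥ n-k} (f^μ)^{2+ε} < (|X||Y||Z|)^{(2+ε)/3}`.

Idea (card `Cruxes/SnLevelDesigns/Ideas/fixed-set-certificates.md`, triage r1-1/2/3: pass ×3):
for a target `t = x₀⁻¹ z₀` the function `g ↦ G(Fix(t⁻¹ g))`, `G(S) = ∑_{|T| ≤ k} w_T [T ⊆ S]` a set
function of subset-degree `≤ k`, is a `k`-token test function (each `[T ⊆ Fix(t⁻¹g)] = [g|_T = t|_T]`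
is a `|T|`-coset indicator); it reads `G([n]) = ∑ w = 1` at the target quadruples and separates the
target as soon as `G` vanishes on the fixed-point sets of the non-target "hexagon differences"
`t⁻¹ x⁻¹ y y'⁻¹ z`.  So `k`-token separation has the explicit SUFFICIENT criterion
`FixedSetCertified` (no linear algebra in dimension `D_k ≈ n^{2k}/k!`, only fixed-point sets of
words of length `≤ 8`), and the crux follows from a family of certified triples near the graded wall.

Skeleton (4 registered stubs + the kernel-checked composition `SnLevelDesigns_of`):
* `stub_fixedSetToken : FixedSetToken` — the lever: fixed-set polynomials of subset-degree `≤ k`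
  are `k`-token functions (tuple-padding encoding of `≤ k`-sets; guard `k ≤ n`).           [M]
* `stub_dimensionDecay : DimensionDecay` — the analytic heart of the ε-bookkeeping: for `k ≥ k₁`,
  `n ≥ k²`, every level-`k` dimension `f^μ` (`μ₁ ≥ n-k`) is `≤ e^{-c√k} √D_k(n)`,
  `D_k(n) = ∑_{μ₁ ≥ n-k} (f^μ)²` (first-row peeling `f^{(n-j,ν)} ≤ C(n,j) f^ν`, the Vershik–Kerov
  upper bound `VershikKerov1985_maxCharDegree_holds`, and `D_k(n) ≥ C(n,k)² k! e^{-2k/(n-2k+1)}`). [L]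
* `stub_transfer : WallTransfer` (`:= DimensionDecay → GammaSeparatedFamily → SnLevelDesigns`) — the
  ε-free wall form of the crux (shared with every constructive line of this crux; = the merged
  ε-glue of cards poly-slack-transfer ≈ classical-sandwich-gamma-scale): separated families with
  `V^{1/3} ≥ e^{-c√k} √D_k(n)` for EVERY `c > 0` along `k → ∞` give the crux
  (`budget ≤ F^ε · D_k ≤ e^{-c'ε√k} D_k^{1+ε/2}` against `V^{(2+ε)/3} ≥ e^{-c(2+ε)√k} D_k^{1+ε/2}`,
  choose `c < c'ε/(2+ε)`).                                                                    [M]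
* `stub_certifiedFamily : CertifiedGammaFamily` — THE CONSTRUCTION (hardest, open): fixed-set
  certified triples with `V^{1/3} ≥ e^{-c√k} √D_k(n)`, every `c > 0`, `k → ∞`, `n ≥ k²`.     [XL/open]

`SnLevelDesigns_of : SnLevelDesigns` is the closed term
`stub_transfer stub_dimensionDecay (gammaSeparatedFamily_of_certified stub_fixedSetToken stub_certifiedFamily)`:
certified ⇒ separated (kernel-checked `sep_of_fixedSetCertified`: `G(Fix(1)) = G([n]) = 1` at the
target) ⇒ `GammaSeparatedFamily` ⇒ crux.  Hypothesis form:
`FixedSetToken → DimensionDecay → WallTransfer → CertifiedGammaFamily → SnLevelDesigns`.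

Disproof used (`Cruxes/SnLevelDesigns/Disproof.lean`, cdisprove v3, verdict NO KILL, no
`_false_without_` theorem): the stub set honours the dead corners (`Negative.DeadCorners`: levels
0, 1 dead, `n ≤ 1` dead — `CertifiedGammaFamily` forces `k → ∞`, `n ≥ k²`), the dimension walls
(`Negative.DimensionWalls`: `|X||Z| ≤ dim T_k`; certified ⇒ separated, so every wall applies to
certified triples — this is CDF87 Thm 2.5 for cross-certified target families), the covering wall
and the graded Neumann count (`Negative.NeumannLevelK`: `V ≤ 0.385 (dim T_k)^{3/2}` — a constant,
immaterial at slack `e^{-o(√k)}`), and the `(ℤ/2)^{k+1}`-coset obstruction (a certified target has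
no cube coset through it inside `Q`; fixed-set form: no `k`-wise null design on the fixed sets of the
relative hexagon differences with non-zero weight at `[n]`, triage r1-3).

`sorry` appears ONLY inside the four `stub_*` theorems.

LEAD (prover-line-stmt-MatrixMultiplication-7613-1, 2026-08-16, re-seat after lead-0's promote-stub on the garnir line):
this skeleton is ADOPTED UNCHANGED (4 registered stubs, same signatures). Wave 1 = stub_fixedSetToken / stub_dimensionDecay
/ stub_transfer (the last two are corollaries of the garnir line's LANDED glue `nw_decay`, `stub_nearWallGlue`,
`stub_firstRowHooks`, regime `3k ≤ n ⊇ k² ≤ n`); the lead holds stub_certifiedFamily (construction and its negation: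
exact certified-vs-separated volumes at small (n,k), structured habitats, cross-Kiyota wall).
-/

set_option linter.dupNamespace false

noncomputable section

namespace Summit.MatrixMultiplication.MatrixMultiplication.Cruxes.SnLevelDesigns.FixedSetCertificates

open scoped BigOperators
open Summit.MatrixMultiplication.MatrixMultiplication.Theses.LevelGradedCohnUmans
open Summit.MatrixMultiplication.MatrixMultiplication.Theorems.SnLevelDesigns.Negative (Sep budget At snLevelDesigns_iff)
open Literature.NumberTheory.DiophantineGeometry (numStandardTableaux numStandardTableaux_pos_holds)

/-! ## Vocabulary -/

/-- The fixed-point set `Fix(σ) ⊆ [n]` of a permutation. -/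
def fixSet {n : ℕ} (σ : Equiv.Perm (Fin n)) : Finset (Fin n) :=
  Finset.univ.filter fun i => σ i = i

/-- The fixed-set polynomial with coefficient table `w` (a set function `G(S) = ∑_{T ⊆ S} w T`),
read at the fixed-point set of the relative difference `t⁻¹ g`:  `g ↦ G(Fix(t⁻¹ g))`. -/
def fixedSetFn {n : ℕ} (w : Finset (Fin n) → ℂ) (t g : Equiv.Perm (Fin n)) : ℂ :=
  ∑ S ∈ (fixSet (t⁻¹ * g)).powerset, w S

/-- **Lever (first lemma of the card).** For `k ≤ n`, every fixed-set polynomial of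
subset-degree `≤ k` (coefficients `w T = 0` for `|T| > k`), read at `Fix(t⁻¹ g)`, is a
`k`-token test function of `g`: `∑_{p : [k] → [n]} c p (g ∘ p) = ∑_{T ⊆ Fix(t⁻¹ g)} w T` for a
suitable table `c` (encode a non-empty `≤ k`-set `T` by the `k`-tuple listing `T` increasingly and
padded with its last element, put `c p_T r := w T · [r = t ∘ p_T]`, and spread `w ∅` as the
constant `w ∅ / n^k` over all `p`; then `[g ∘ p_T = t ∘ p_T] = [T ⊆ Fix(t⁻¹ g)]`). -/
def FixedSetToken : Prop :=
  ∀ (n k : ℕ), k ≤ n → ∀ w : Finset (Fin n) → ℂ, (∀ S, k < S.card → w S = 0) →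
    ∀ t : Equiv.Perm (Fin n), ∃ c : (Fin k → Fin n) → (Fin k → Fin n) → ℂ,
      ∀ g : Equiv.Perm (Fin n), (∑ p : Fin k → Fin n, c p (⇑g ∘ p)) = fixedSetFn w t g

/-- **Fixed-set certificate** for a triple `X, Y, Z ⊆ 𝔖ₙ` at level `k`: for every target
`(x₀, z₀)` a coefficient table `w` supported on `≤ k`-sets with `∑ w = G([n]) = 1` whose
fixed-set polynomial vanishes at `Fix(t⁻¹ q)`, `t = x₀⁻¹ z₀`, for every NON-target hexagon
product `q = x⁻¹ y y'⁻¹ z`.  (The hypothesis itself excludes `q = t` at a non-target, since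
`Fix(1) = [n]` would give the value `1`; so no separate TPP clause is needed.) -/
def FixedSetCertified (n k : ℕ) (X Y Z : Finset (Equiv.Perm (Fin n))) : Prop :=
  ∀ x₀ ∈ X, ∀ z₀ ∈ Z, ∃ w : Finset (Fin n) → ℂ, (∀ S, k < S.card → w S = 0) ∧ (∑ S, w S) = 1 ∧
    ∀ x ∈ X, ∀ y ∈ Y, ∀ y' ∈ Y, ∀ z ∈ Z, ¬ (x = x₀ ∧ y = y' ∧ z = z₀) →
      fixedSetFn w (x₀⁻¹ * z₀) (x⁻¹ * y * y'⁻¹ * z) = 0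

/-- The graded dimension `D_k(n) = ∑_{μ ⊢ n, μ₁ ≥ n-k} (f^μ)²` (`= dim T_k = #{π : lis π ≥ n-k}`),
written with the crux's own partition sum at exponent `2` (it is `budget n k 0`). -/
def levelDim (n k : ℕ) : ℝ :=
  ∑ μ : Nat.Partition n, if n - k ≤ μ.parts.sup then (numStandardTableaux μ : ℝ) ^ (2 : ℝ) else 0

/-- **Dimension decay along `k → ∞`** (the analytic heart of the ε-bookkeeping): there are `c > 0`
and `k₁` such that for all `k ≥ k₁`, `n ≥ k²` and every level-`k` shape `μ` (`μ₁ ≥ n - k`),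
`f^μ ≤ e^{-c√k} · √D_k(n)`.  Route: `μ = (n-j, ν)`, `ν ⊢ j ≤ k`, `f^μ ≤ C(n,j) f^ν ≤ C(n,j)·D(j)`
with `D(j) = maxCharDegree 𝔖_j ≤ √(j!) e^{-(c₂-δ)√j}` (`VershikKerov1985_maxCharDegree_holds`,
`numStandardTableaux_le_maxCharDegree`), against `D_k(n) ≥ ∑_{ν ⊢ k} (f^{(n-k,ν)})² ≥
C(n,k)² k! e^{-2k/(n-2k+1)}` (hook lengths in the first row); the terms `j < k` carry the extra
factor `(√k/(n-k))^{k-j} ≤ k^{-3(k-j)/2}`. -/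
def DimensionDecay : Prop :=
  ∃ c : ℝ, 0 < c ∧ ∃ k₁ : ℕ, ∀ k : ℕ, k₁ ≤ k → ∀ n : ℕ, k ^ 2 ≤ n → ∀ μ : Nat.Partition n,
    n - k ≤ μ.parts.sup →
      (numStandardTableaux μ : ℝ) ≤ Real.exp (-(c * Real.sqrt (k : ℝ))) * Real.sqrt (levelDim n k)

/-- **`Γ`-subexponential separated families** (the ε-free wall form of the crux; identical in
content to `GammaSubexp` of `Ideator1Sketch.lean`): for every `c > 0` there are arbitrarily large
levels `k`, some `n ≥ k²` and a `k`-token separated triple with `e^{-c√k} √D_k(n) ≤ (|X||Y||Z|)^{1/3}`. -/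
def GammaSeparatedFamily : Prop :=
  ∀ c : ℝ, 0 < c → ∀ k₀ : ℕ, ∃ k : ℕ, k₀ ≤ k ∧ ∃ n : ℕ, k ^ 2 ≤ n ∧
    ∃ X Y Z : Finset (Equiv.Perm (Fin n)), Sep n k X Y Z ∧
      Real.exp (-(c * Real.sqrt (k : ℝ))) * Real.sqrt (levelDim n k) ≤
        ((X.card * Y.card * Z.card : ℕ) : ℝ) ^ ((1 : ℝ) / 3)

/-- **C⁺ — the construction target of the line**: the same family, but FIXED-SET CERTIFIED
instead of merely separated.  Strictly stronger than what the crux needs (diagonal separators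
only); why easier: the hypothesis mentions only fixed-point sets of words of length `≤ 8` in
`X ∪ Y ∪ Z`, so candidate families are certified or killed by counting. -/
def CertifiedGammaFamily : Prop :=
  ∀ c : ℝ, 0 < c → ∀ k₀ : ℕ, ∃ k : ℕ, k₀ ≤ k ∧ ∃ n : ℕ, k ^ 2 ≤ n ∧
    ∃ X Y Z : Finset (Equiv.Perm (Fin n)), FixedSetCertified n k X Y Z ∧
      Real.exp (-(c * Real.sqrt (k : ℝ))) * Real.sqrt (levelDim n k) ≤
        ((X.card * Y.card * Z.card : ℕ) : ℝ) ^ ((1 : ℝ) / 3)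

/-- **The transfer** (ε-bookkeeping, wall form ⇒ crux): given the dimension decay, every
`Γ`-subexponential separated family yields `SnLevelDesigns`.  Named so that the composition
`SnLevelDesigns_of` below is a closed term over the stubs (the crux is concluded BY NAME only there; LEAD reshape 0:
the conclusion is written as `∀ ε > 0, ∃ n k X Y Z, Negative.At ε n k X Y Z`, which is `SnLevelDesigns` unfolded once —
`Negative.snLevelDesigns_iff` is `Iff.rfl` — so that no stub's type is headed by the crux name). -/
def WallTransfer : Prop :=
  DimensionDecay → GammaSeparatedFamily →
    ∀ ε : ℝ, 0 < ε → ∃ (n k : ℕ) (X Y Z : Finset (Equiv.Perm (Fin n))), At ε n k X Y Z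

/-! ## Registered stubs (the only `sorry`s of the line) -/

/-- **stub_fixedSetToken** (M): fixed-set polynomials of subset-degree `≤ k` are `k`-token functions
(statement = `FixedSetToken`, spelled out in tree-only vocabulary so that the landing Theorems file can state it verbatim). -/
theorem stub_fixedSetToken :
    ∀ (n k : ℕ), k ≤ n → ∀ w : Finset (Fin n) → ℂ, (∀ S, k < S.card → w S = 0) →
      ∀ t : Equiv.Perm (Fin n), ∃ c : (Fin k → Fin n) → (Fin k → Fin n) → ℂ,
        ∀ g : Equiv.Perm (Fin n), (∑ p : Fin k → Fin n, c p (⇑g ∘ p)) =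
          ∑ S ∈ (Finset.univ.filter fun i : Fin n => (t⁻¹ * g) i = i).powerset, w S :=
  -- LANDED p97299 (wave 1): `Theorems/LevelGradedCohnUmansSnLevelDesignsStubFixedSetToken.lean`
  Summit.MatrixMultiplication.MatrixMultiplication.Theorems.SnLevelDesigns.stub_fixedSetToken

/-- **stub_dimensionDecay** (L→S, provable now): Vershik–Kerov dimension decay at level `k` of `𝔖ₙ`, `n ≥ k²`
(statement = `DimensionDecay`, tree-only vocabulary). LEAD NOTE: a corollary of the garnir line's landed
`Theorems.SnLevelDesigns.nw_decay` + `stub_firstRowHooks` (regime `3k ≤ n`, implied by `k² ≤ n` for `k ≥ 3`):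
`(f^μ)² ≤ e^{2-c√k} D_k` gives `f^μ ≤ e^{-(c/4)√k} √D_k` once `c√k ≥ 4`; the `ℕ`-sum of squares there equals the
`ℝ`-sum with exponent `(2 : ℝ)` here (`Real.rpow_two` / `Real.rpow_natCast`). -/
theorem stub_dimensionDecay :
    ∃ c : ℝ, 0 < c ∧ ∃ k₁ : ℕ, ∀ k : ℕ, k₁ ≤ k → ∀ n : ℕ, k ^ 2 ≤ n → ∀ μ : Nat.Partition n,
      n - k ≤ μ.parts.sup →
        (Literature.NumberTheory.DiophantineGeometry.numStandardTableaux μ : ℝ) ≤ Real.exp (-(c * Real.sqrt (k : ℝ))) *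
          Real.sqrt (∑ ν : Nat.Partition n,
            if n - k ≤ ν.parts.sup then (Literature.NumberTheory.DiophantineGeometry.numStandardTableaux ν : ℝ) ^ (2 : ℝ) else 0) :=
  -- LANDED p101416 (wave 1): `Theorems/LevelGradedCohnUmansSnLevelDesignsStubDimensionDecay.lean`
  Summit.MatrixMultiplication.MatrixMultiplication.Theorems.SnLevelDesigns.stub_dimensionDecay

/-- **stub_transfer** (M, provable now): `DimensionDecay → GammaSeparatedFamily → SnLevelDesigns`
(`budget(n,k,ε) ≤ (max f^μ)^ε · D_k ≤ e^{-c'ε√k} D_k^{1+ε/2}` while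
`V^{(2+ε)/3} ≥ e^{-c(2+ε)√k} D_k^{1+ε/2}`; take `c := c'ε/(2(2+ε))` and `k₀ ≥ max k₁ 1`;
`budget ≥ 1`, `D_k ≥ 1` from `Negative.one_le_budget`). Statement = `WallTransfer` in tree-only vocabulary.
LEAD NOTE: the shortest proof ignores the first hypothesis and feeds `P := Sep` into the garnir line's LANDED
`Theorems.SnLevelDesigns.stub_nearWallGlue stub_firstRowHooks` (NearWall with `δ := 3c`: `e^{-c√k}√D ≤ V^{1/3}` ⇔
`D^{3/2} ≤ e^{3c√k} V`; `3k ≤ k² ≤ n` for `k ≥ 3`); its conclusion `Sep ∧ budget < V^{(2+ε)/3}` is `SnLevelDesigns` verbatim. -/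
theorem stub_transfer :
    (∃ c : ℝ, 0 < c ∧ ∃ k₁ : ℕ, ∀ k : ℕ, k₁ ≤ k → ∀ n : ℕ, k ^ 2 ≤ n → ∀ μ : Nat.Partition n,
      n - k ≤ μ.parts.sup →
        (Literature.NumberTheory.DiophantineGeometry.numStandardTableaux μ : ℝ) ≤ Real.exp (-(c * Real.sqrt (k : ℝ))) *
          Real.sqrt (∑ ν : Nat.Partition n,
            if n - k ≤ ν.parts.sup then (Literature.NumberTheory.DiophantineGeometry.numStandardTableaux ν : ℝ) ^ (2 : ℝ) else 0)) →
    (∀ c : ℝ, 0 < c → ∀ k₀ : ℕ, ∃ k : ℕ, k₀ ≤ k ∧ ∃ n : ℕ, k ^ 2 ≤ n ∧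
      ∃ X Y Z : Finset (Equiv.Perm (Fin n)), Summit.MatrixMultiplication.MatrixMultiplication.Theorems.SnLevelDesigns.Negative.Sep n k X Y Z ∧
        Real.exp (-(c * Real.sqrt (k : ℝ))) *
            Real.sqrt (∑ ν : Nat.Partition n,
              if n - k ≤ ν.parts.sup then (Literature.NumberTheory.DiophantineGeometry.numStandardTableaux ν : ℝ) ^ (2 : ℝ) else 0) ≤
          ((X.card * Y.card * Z.card : ℕ) : ℝ) ^ ((1 : ℝ) / 3)) →
    ∀ ε : ℝ, 0 < ε → ∃ (n k : ℕ) (X Y Z : Finset (Equiv.Perm (Fin n))),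
      Summit.MatrixMultiplication.MatrixMultiplication.Theorems.SnLevelDesigns.Negative.At ε n k X Y Z := by
  sorry

/-- **stub_certifiedFamily** (XL, open — the HARDEST): near-wall fixed-set certified families exist.
Standing constraints (line card): one sharp group is dead (Blichfeldt/Kiyota: `V ≤ |G|^{3/2} ≤
n^{1.5k} ≪ D_k^{3/2}`), so designs mix at least two structures; `Y` must be a degree-`k`
annihilable difference family (met by thinned `AGL_d(𝔽_q)`, `k = d+1`); generic mixing has Poisson
fixities and is never certified (first-moment count, triage r1-3). -/
theorem stub_certifiedFamily :
    ∀ c : ℝ, 0 < c → ∀ k₀ : ℕ, ∃ k : ℕ, k₀ ≤ k ∧ ∃ n : ℕ, k ^ 2 ≤ n ∧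
      ∃ X Y Z : Finset (Equiv.Perm (Fin n)),
        (∀ x₀ ∈ X, ∀ z₀ ∈ Z, ∃ w : Finset (Fin n) → ℂ, (∀ S, k < S.card → w S = 0) ∧ (∑ S, w S) = 1 ∧
          ∀ x ∈ X, ∀ y ∈ Y, ∀ y' ∈ Y, ∀ z ∈ Z, ¬ (x = x₀ ∧ y = y' ∧ z = z₀) →
            (∑ S ∈ (Finset.univ.filter fun i : Fin n =>
                ((x₀⁻¹ * z₀)⁻¹ * (x⁻¹ * y * y'⁻¹ * z)) i = i).powerset, w S) = 0) ∧
        Real.exp (-(c * Real.sqrt (k : ℝ))) *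
            Real.sqrt (∑ ν : Nat.Partition n,
              if n - k ≤ ν.parts.sup then (Literature.NumberTheory.DiophantineGeometry.numStandardTableaux ν : ℝ) ^ (2 : ℝ) else 0) ≤
          ((X.card * Y.card * Z.card : ℕ) : ℝ) ^ ((1 : ℝ) / 3) := by
  sorry

/-! ## Composition (kernel-checked, no `sorry`) -/

/-- `Fix(1) = [n]`. -/
theorem fixSet_one (n : ℕ) : fixSet (1 : Equiv.Perm (Fin n)) = Finset.univ := by
  ext i
  simp [fixSet]

/-- At the target the fixed-set polynomial reads `G([n]) = ∑ w`. -/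
theorem fixedSetFn_self {n : ℕ} (w : Finset (Fin n) → ℂ) (t : Equiv.Perm (Fin n)) :
    fixedSetFn w t t = ∑ S, w S := by
  unfold fixedSetFn
  rw [inv_mul_cancel, fixSet_one, Finset.powerset_univ]

/-- Certified ⇒ separated (the card's `stub_sep_of_fixedSet`, derived from the lever). -/
theorem sep_of_fixedSetCertified (hTok : FixedSetToken) {n k : ℕ} (hkn : k ≤ n)
    {X Y Z : Finset (Equiv.Perm (Fin n))} (hcert : FixedSetCertified n k X Y Z) :
    Sep n k X Y Z := by
  intro x₀ hx₀ z₀ hz₀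
  obtain ⟨w, hwdeg, hwsum, hzero⟩ := hcert x₀ hx₀ z₀ hz₀
  obtain ⟨c, hc⟩ := hTok n k hkn w hwdeg (x₀⁻¹ * z₀)
  refine ⟨c, fun x hx y hy y' hy' z hz => ?_⟩
  rw [hc]
  by_cases htgt : x = x₀ ∧ y = y' ∧ z = z₀
  · obtain ⟨rfl, rfl, rfl⟩ := htgt
    rw [if_pos ⟨rfl, rfl, rfl⟩]
    have h1 : x⁻¹ * y * y⁻¹ * z = x⁻¹ * z := by group
    rw [h1, fixedSetFn_self, hwsum]
  · rw [if_neg htgt]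
    exact hzero x hx y hy y' hy' z hz htgt

/-- Certified `Γ`-subexponential families are separated `Γ`-subexponential families
(the lever applied target by target; `k ≤ k² ≤ n` supplies the guard). -/
theorem gammaSeparatedFamily_of_certified (hTok : FixedSetToken) (hFam : CertifiedGammaFamily) :
    GammaSeparatedFamily := by
  intro c hc k₀
  obtain ⟨k, hk, n, hn, X, Y, Z, hcert, hvol⟩ := hFam c hc k₀
  have hkn : k ≤ n := le_trans (Nat.le_self_pow two_ne_zero k) hn
  exact ⟨k, hk, n, hn, X, Y, Z, sep_of_fixedSetCertified hTok hkn hcert, hvol⟩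

/-- **The line concludes the crux** (closed term over the four stubs, no hypotheses; the only
theorem of this file whose conclusion is the route decl `SnLevelDesigns`, by name):
certified families (`stub_certifiedFamily`) are separated families (`stub_fixedSetToken`), and
separated `Γ`-subexponential families give `SnLevelDesigns` (`stub_transfer` fed with
`stub_dimensionDecay`).  In hypothesis form:
`FixedSetToken → DimensionDecay → WallTransfer → CertifiedGammaFamily → SnLevelDesigns`. -/
theorem SnLevelDesigns_of : SnLevelDesigns :=
  snLevelDesigns_iff.mpr
    ((stub_transfer : WallTransfer) (stub_dimensionDecay : DimensionDecay)
      (gammaSeparatedFamily_of_certified (stub_fixedSetToken : FixedSetToken)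
        (stub_certifiedFamily : CertifiedGammaFamily)))

end Summit.MatrixMultiplication.MatrixMultiplication.Cruxes.SnLevelDesigns.FixedSetCertificates

end
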